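import Literature.Barriers.CriticalPhenomena.LaceExpansionGaussianDeconvolutionProp24Prelim
import Literature.Barriers.CriticalPhenomena.LaceExpansionIsingDeconvolutionFourier
import Literature.Barriers.CriticalPhenomena.HaraGaussianLemmaLatticeSums
import Mathlib.Analysis.SpecialFunctions.Pow.Integral
import Mathlib.Analysis.SpecialFunctions.ImproperIntegrals
import HarnessLib

/-!
# Liu–Slade 2024, Lemmas 2.6 and 2.14: `L^q(𝕋^d)` bounds for lattice Fourier series with
# power-decaying coefficients (the Hausdorff–Young-type inputs of Propositions 2.4, 2.11 and of
# Liu–Slade 2026, Proposition 3.2), proved by real interpolation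

Barrier catalogue `Literature/Barriers/CriticalPhenomena/` (D-0021), analysis support for the two
Gaussian-deconvolution theorems on the path of Sakai's theorem for the spread-out Ising model
(`LiuSlade2024_thm12_critical`, `LiuSlade2026_thm22` of `LaceExpansionIsingDeconvolutionParts.lean`).
Both printed proofs bound the factors `F̂_γ/F̂`, `Ê_γ/(ÂF̂)` (resp. `Π̂_γ`) in `L^q(𝕋^d)` through
Liu–Slade 2024, Lemma 2.6:

> "Let `h : ℤ^d → ℝ` obey `|h(x)| ≤ K⟦x⟧^{-b}` for some `K, b > 0`. (i) If `b > d` then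
> `h ∈ ℓ¹(ℤ^d)`, `ĥ ∈ L^∞(𝕋^d)`, and `‖ĥ‖_∞ ≤ c_{d,b} K`. (ii) If `b ≤ d` then `h ∈ ℓ^p(ℤ^d)` for
> `p > d/b`. If also `d/2 < b ≤ d` then `ĥ ∈ L^q(𝕋^d)` and `‖ĥ‖_q ≤ c_{d,b,q} K` for all
> `1 ≤ q < d/(d-b)`,"

whose part (ii) is proved in the source by the Hausdorff–Young inequality (`ℓ^p → L^{p'}`,
`1 ≤ p ≤ 2`), which Mathlib does not have. This file PROVES Lemma 2.6 — part (ii) for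
`2 ≤ q < d/(d-b)` (the range `1 ≤ q < 2` being the monotonicity of `L^q`-norms on the
probability space `𝕋^d`, exactly as in the source, and already in the tree as
`isWLT_of_bound_two_le`) — by REAL INTERPOLATION done by hand, with no interpolation theorem:

* split `g = g₁ + g₂` at a frequency radius `R`: `g₁ = Σ_{|x| ≤ R} ĝ(x)e_x` is a trigonometric
  polynomial with `‖g₁‖_∞ ≤ K Σ_{|x|≤R}⟦x⟧^{-b} ≤ K C₁ R^{d-b}` (the tree's lattice ball sums,
  `exists_tsum_ball_jnorm_rpow_neg_le`), and `‖g₂‖₂² = Σ_{|x|>R}|ĝ(x)|² ≤ K² C₂ R^{d-2b}` by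
  Parseval (`Torus.hasSum_sq_norm_mFourierCoeff`) and the lattice tail sums
  (`exists_tsum_tail_jnorm_rpow_neg_le`);
* choosing `R^{d-b} = s/(2K(C₁+1))` makes `‖g₁‖_∞ ≤ s/2`, so Chebyshev's inequality gives the
  WEAK-TYPE bound `vol{|g| > s} ≤ vol{|g₂| > s/2} ≤ A K^{q₀} s^{-q₀}` with `q₀ = d/(d-b) > 2`
  for `s ≥ 2(C₁+1)K` (`measureReal_norm_gt_le`);
* the layer-cake formula (Mathlib's `lintegral_rpow_eq_lintegral_meas_lt_mul`) integrates the
  weak-type bound to `‖g‖_q^q ≤ (cK)^q` for every `q < q₀` (`lintegral_rpow_le_of_meas_gt_le`).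

The statement is given for any `g ∈ L²(𝕋^d)` whose Fourier coefficients obey
`|ĝ(x)| ≤ K⟦x⟧^{-b}` (complex coefficients allowed): for `h ∈ ℓ²` this `g` is the `L²` Fourier
transform of `h` (Riesz–Fischer, the tree's `exists_memLp_two_mFourierCoeff_eq`), and for finitely
supported `h` it is the trigonometric polynomial `Σ_x h(x) e_x` (`Torus.trigPoly`,
`Torus.mFourierCoeff_trigPoly`), with constants INDEPENDENT of the support — the form consumed by
the weak Lebesgue classes of `LaceExpansionGaussianDeconvolutionProp24Prelim.lean`
(`isWLT_of_mFourierCoeff_decay`: a family with uniformly `⟦x⟧^{-b}`-decaying coefficients,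
`b > d/2`, is of class `(d - b) ∨ 0`).

## Main results (all proved; namespace `Literature.Barriers.CriticalPhenomena.SpreadOutIsing`)

* `LiuSlade2024_lem26_i` — part (i): `b > d` ⟹ `Σ|c_x| < ∞`, `|Σ c_x e_x(t)| ≤ c_{d,b} K`;
* `summable_norm_rpow_of_decay` — part (ii), first clause: `Σ|c_x|^p < ∞` for `pb > d`;
* `LiuSlade2024_lem26_ii` — part (ii): `d/2 < b < d`, `2 ≤ q < d/(d-b)` ⟹ `g ∈ L^q`,
  `‖g‖_q ≤ c_{d,b,q} K`; `LiuSlade2024_lem26_ii_of_le` — the endpoint `b ≥ d`: every `2 ≤ q < ∞`;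
* `exists_memLp_two_of_decay` — Riesz–Fischer: such coefficients (`b > d/2`) ARE the Fourier
  coefficients of an `L²` function;
* `isWLT_of_mFourierCoeff_decay`, `isWLT_trigPoly_of_decay` — the same as weak-Lebesgue-class
  statements (families of `L²` functions, resp. of trigonometric polynomials, with uniformly
  decaying coefficients);
* `LiuSlade2024_lem214_i`, `LiuSlade2024_lem214_ii`, `LiuSlade2024_lem214_ii_of_le` — **Lemma 2.14**
  (the smeared version for the difference operator `U_u = torusDiff j u`:
  `‖U_u ĥ‖_q ≤ c |u|^η K` for `d/2 + η < b < d + η`, `2 ≤ q < d/(d-b+η)`, resp. the endpoint and the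
  `L^∞` case `b > d + η`), through `norm_mFourierCoeff_torusDiff_le`
  (`|𝓕(U_u g)(x)| ≤ 2(2π)^η|u|^η K⟦x⟧^{-(b-η)}`) and Lemma 2.6 with `b - η`;
  `isWLT_torusDiff_of_mFourierCoeff_decay` — the same as a weak Lebesgue class of the rescaled
  family `|u|^{-η} U_u Φ_i` (class `(d - b + η) ∨ 0`);
* the tools: `measureReal_norm_gt_le` (weak type), `lintegral_rpow_le_of_meas_gt_le` (layer cake,
  abstract probability space), `integral_norm_sq_sub_trigPoly_le` (Parseval for the high part),
  `memLp_torusDiff` (translation invariance).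

## References

* Y. Liu, G. Slade, *Gaussian deconvolution and the lace expansion*, Probab. Theory Related
  Fields 195 (2024) 3–29, arXiv:2310.07635: Lemma 2.6 and its proof (§2.2.2); its uses: proof of
  Lemma 2.5 ((2.19)–(2.20)); §2.3.1 (`U_u`), Lemma 2.14 and its proof (§2.3.3), Lemma 2.12
  [LiuSlade2024].
* Y. Liu, G. Slade, *Gaussian deconvolution and the lace expansion for spread-out models*,
  Ann. Inst. H. Poincaré Probab. Statist. 62 (2026), arXiv:2310.07640: Lemma 3.3 and Prop. 3.2
  ("the Hausdorff–Young bounds of [LS24a, Lemma 2.6]") [LiuSlade2026].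
* L. Grafakos, *Classical Fourier Analysis*, 3rd ed., Springer 2014: Prop. 3.2.7 (Parseval on
  `𝕋^d`), §1.1.2 (distribution functions and the layer-cake representation of `L^p` norms),
  §1.3–1.4 (real interpolation) [Grafakos2014].
-/

noncomputable section

namespace Literature.Barriers.CriticalPhenomena.SpreadOutIsing

open Filter Finset UnitAddTorus Literature.Probability.LatticeModels
open Literature.Analysis.FunctionSpaces
open _root_.MeasureTheory _root_.Topology
open scoped ENNReal NNReal

variable {d : ℕ}

/-! ## Part 1. The splitting `g = g₁ + g₂` at frequency radius `R` -/

/-- The lattice points of the Euclidean ball `|y| ≤ R` form a finite set. [folklore] -/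
theorem exists_finset_ball (R : ℝ) :
    ∃ S : Finset (Site d), ∀ y : Site d, y ∈ S ↔ euclidNorm y ≤ R := by
  classical
  refine ⟨(box d ⌊R⌋₊).filter fun y => euclidNorm y ≤ R, fun y => ?_⟩
  rw [Finset.mem_filter]
  exact ⟨fun h => h.2, fun h => ⟨mem_box_floor_of_euclidNorm_le h, h⟩⟩

/-- The `ℓ¹` mass of power-decaying coefficients on the ball `|x| ≤ R`:
`Σ_{|x| ≤ R} |c_x| ≤ K Σ_{|y| ≤ R} ⟦y⟧^{-b}` when `|c_x| ≤ K ⟦x⟧^{-b}`. [folklore] -/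
theorem sum_norm_le_mul_tsum_ball {S : Finset (Site d)} {R : ℝ} (hS : ∀ y : Site d, y ∈ S ↔ euclidNorm y ≤ R)
    {c : Site d → ℂ} {K b : ℝ} (hc : ∀ x : Site d, ‖c x‖ ≤ K / jnorm x ^ b) :
    ∑ x ∈ S, ‖c x‖ ≤
      K * ∑' y, {y : Site d | euclidNorm y ≤ R}.indicator (fun y => jnorm y ^ (-b)) y := by
  have hsum : ∑' y, {y : Site d | euclidNorm y ≤ R}.indicator (fun y => jnorm y ^ (-b)) y =
      ∑ y ∈ S, jnorm y ^ (-b) := by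
    rw [tsum_eq_sum (s := S)
      (f := fun y => {y : Site d | euclidNorm y ≤ R}.indicator (fun y => jnorm y ^ (-b)) y) ?_]
    · refine Finset.sum_congr rfl fun y hy => ?_
      exact Set.indicator_of_mem (show y ∈ {y : Site d | euclidNorm y ≤ R} from (hS y).1 hy) _
    · intro y hy
      exact Set.indicator_of_notMem (show y ∉ {y : Site d | euclidNorm y ≤ R} from
        fun h => hy ((hS y).2 h)) _
  rw [hsum, Finset.mul_sum]
  refine Finset.sum_le_sum fun x _ => (hc x).trans (le_of_eq ?_)
  rw [Real.rpow_neg (jnorm_pos x).le, div_eq_mul_inv]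

/-- The low-frequency part `g₁ = Σ_{|x| ≤ R} ĝ(x) e_x` of an `L²` function is uniformly small:
`|g₁(t)| ≤ K Σ_{|y| ≤ R} ⟦y⟧^{-b}` under `|ĝ(x)| ≤ K⟦x⟧^{-b}`. [cite: LiuSlade2024, Lemma 2.6 (i) (ℓ¹ coefficients give L^∞ transforms)] -/
theorem norm_trigPoly_ball_le {S : Finset (Site d)} {R : ℝ} (hS : ∀ y : Site d, y ∈ S ↔ euclidNorm y ≤ R)
    {g : UnitAddTorus (Fin d) → ℂ} {K b : ℝ} (hg : ∀ x : Site d, ‖mFourierCoeff g x‖ ≤ K / jnorm x ^ b)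
    (t : UnitAddTorus (Fin d)) :
    ‖Torus.trigPoly S (mFourierCoeff g) t‖ ≤
      K * ∑' y, {y : Site d | euclidNorm y ≤ R}.indicator (fun y => jnorm y ^ (-b)) y :=
  (norm_trigPoly_le S _ t).trans (sum_norm_le_mul_tsum_ball hS hg)

/-- The Fourier coefficients of the high-frequency part `g₂ = g - g₁`: `ĝ₂(x) = ĝ(x)` for
`|x| > R` and `0` for `|x| ≤ R`. [folklore] -/
theorem mFourierCoeff_sub_trigPoly {S : Finset (Site d)} {g : UnitAddTorus (Fin d) → ℂ}
    (hg : Integrable g) (x : Site d) :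
    mFourierCoeff (fun t => g t - Torus.trigPoly S (mFourierCoeff g) t) x =
      if x ∈ S then 0 else mFourierCoeff g x := by
  rw [mFourierCoeff_sub hg (Torus.continuous_trigPoly S _).integrable_unitAddTorus,
    Torus.mFourierCoeff_trigPoly]
  split_ifs <;> simp

/-- The high-frequency part is in `L²` with `∫ |g₂|² = Σ_{|x| > R} |ĝ(x)|² ≤ K² Σ_{|y| > R} ⟦y⟧^{-2b}`
(Parseval). [cite: LiuSlade2024, Lemma 2.6 (ii) ("the condition b > d/2 ensures that h ∈ ℓ²(ℤ^d), so that we can use the L² Fourier transform")] -/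
theorem integral_norm_sq_sub_trigPoly_le {S : Finset (Site d)} {R : ℝ}
    (hS : ∀ y : Site d, y ∈ S ↔ euclidNorm y ≤ R) {g : UnitAddTorus (Fin d) → ℂ}
    (hg2 : MemLp g 2 (volume : Measure (UnitAddTorus (Fin d)))) {K b : ℝ}
    (hb : (d : ℝ) < 2 * b) (hg : ∀ x : Site d, ‖mFourierCoeff g x‖ ≤ K / jnorm x ^ b) :
    MemLp (fun t => g t - Torus.trigPoly S (mFourierCoeff g) t) 2 volume ∧
      ∫ t, ‖g t - Torus.trigPoly S (mFourierCoeff g) t‖ ^ 2 ≤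
        K ^ 2 * ∑' y, {y : Site d | euclidNorm y ≤ R}ᶜ.indicator (fun y => jnorm y ^ (-(2 * b))) y := by
  -- `g₁` is bounded and continuous, hence in `L²`
  have h1top : MemLp (Torus.trigPoly S (mFourierCoeff g)) ∞ (volume : Measure (UnitAddTorus (Fin d))) :=
    memLp_top_of_bound (Torus.continuous_trigPoly S _).aestronglyMeasurable
      (∑ x ∈ S, ‖mFourierCoeff g x‖) (ae_of_all _ fun t => norm_trigPoly_le S _ t)
  have h12 : MemLp (Torus.trigPoly S (mFourierCoeff g)) 2 (volume : Measure (UnitAddTorus (Fin d))) :=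
    h1top.mono_exponent le_top
  have hsub : MemLp (fun t => g t - Torus.trigPoly S (mFourierCoeff g) t) 2 volume := hg2.sub h12
  refine ⟨hsub, ?_⟩
  rw [← (Torus.hasSum_sq_norm_mFourierCoeff hsub).tsum_eq]
  have hcoeff : ∀ x, mFourierCoeff (fun t => g t - Torus.trigPoly S (mFourierCoeff g) t) x =
      if x ∈ S then 0 else mFourierCoeff g x :=
    mFourierCoeff_sub_trigPoly (hg2.integrable one_le_two)
  simp_rw [hcoeff]
  -- termwise comparison with the tail sum
  have hterm : ∀ x : Site d, ‖(if x ∈ S then (0 : ℂ) else mFourierCoeff g x)‖ ^ 2 ≤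
      K ^ 2 * {y : Site d | euclidNorm y ≤ R}ᶜ.indicator (fun y => jnorm y ^ (-(2 * b))) x := by
    intro x
    by_cases hx : x ∈ S
    · rw [if_pos hx, norm_zero, zero_pow two_ne_zero]
      exact mul_nonneg (sq_nonneg K) (Set.indicator_nonneg (fun _ _ => Real.rpow_nonneg (jnorm_pos _).le _) x)
    · rw [if_neg hx, Set.indicator_of_mem (show x ∈ {y : Site d | euclidNorm y ≤ R}ᶜ from
        fun h => hx ((hS x).2 h))]
      have hj := jnorm_pos x
      calc ‖mFourierCoeff g x‖ ^ 2 ≤ (K / jnorm x ^ b) ^ 2 := by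
            gcongr
            exact hg x
        _ = K ^ 2 * jnorm x ^ (-(2 * b)) := by
            rw [div_pow, Real.rpow_neg hj.le, ← Real.rpow_natCast (jnorm x ^ b) 2, ← Real.rpow_mul hj.le]
            push_cast
            rw [div_eq_mul_inv, mul_comm b 2]
  have hsum1 : Summable fun x : Site d => ‖(if x ∈ S then (0 : ℂ) else mFourierCoeff g x)‖ ^ 2 := by
    have := (Torus.hasSum_sq_norm_mFourierCoeff hsub).summable
    simp_rw [hcoeff] at this
    exact this
  have hsum2 : Summable fun x : Site d =>
      K ^ 2 * {y : Site d | euclidNorm y ≤ R}ᶜ.indicator (fun y => jnorm y ^ (-(2 * b))) x :=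
    (summable_indicator_compl_ball hb R).mul_left _
  calc ∑' x : Site d, ‖(if x ∈ S then (0 : ℂ) else mFourierCoeff g x)‖ ^ 2
      ≤ ∑' x : Site d, K ^ 2 * {y : Site d | euclidNorm y ≤ R}ᶜ.indicator (fun y => jnorm y ^ (-(2 * b))) x :=
        Summable.tsum_le_tsum hterm hsum1 hsum2
    _ = K ^ 2 * ∑' y, {y : Site d | euclidNorm y ≤ R}ᶜ.indicator (fun y => jnorm y ^ (-(2 * b))) y :=
        tsum_mul_left


/-! ## Part 2. The distribution bound (Chebyshev on the high-frequency part) -/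

/-- **Weak-type estimate.** If the low frequencies carry `ℓ¹` mass at most `s/2`
(`K Σ_{|y| ≤ R} ⟦y⟧^{-b} ≤ s/2`), then `vol{|g| > s} ≤ vol{|g₂| > s/2} ≤ 4K² Σ_{|y|>R}⟦y⟧^{-2b}/s²`
(Chebyshev's inequality and Parseval for `g₂ = g - g₁`). [cite: LiuSlade2024, Lemma 2.6 (ii) and its proof (ℓ² part via the L² Fourier transform)] -/
theorem measureReal_norm_gt_le {g : UnitAddTorus (Fin d) → ℂ}
    (hg2 : MemLp g 2 (volume : Measure (UnitAddTorus (Fin d)))) {K b : ℝ}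
    (hb : (d : ℝ) < 2 * b) (hg : ∀ x : Site d, ‖mFourierCoeff g x‖ ≤ K / jnorm x ^ b)
    {R s : ℝ} (hs : 0 < s)
    (hsmall : K * ∑' y, {y : Site d | euclidNorm y ≤ R}.indicator (fun y => jnorm y ^ (-b)) y ≤ s / 2) :
    volume.real {t : UnitAddTorus (Fin d) | s < ‖g t‖} ≤
      4 * (K ^ 2 * ∑' y, {y : Site d | euclidNorm y ≤ R}ᶜ.indicator (fun y => jnorm y ^ (-(2 * b))) y) / s ^ 2 := by
  obtain ⟨S, hS⟩ := exists_finset_ball (d := d) R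
  obtain ⟨hsub, hint⟩ := integral_norm_sq_sub_trigPoly_le hS hg2 hb hg
  set g₂ : UnitAddTorus (Fin d) → ℂ := fun t => g t - Torus.trigPoly S (mFourierCoeff g) t with hg₂
  -- `|g₁| ≤ s/2` everywhere
  have h1 : ∀ t, ‖Torus.trigPoly S (mFourierCoeff g) t‖ ≤ s / 2 :=
    fun t => (norm_trigPoly_ball_le hS hg t).trans hsmall
  -- `{|g| > s} ⊆ {(s/2)² ≤ |g₂|²}`
  have hincl : {t : UnitAddTorus (Fin d) | s < ‖g t‖} ⊆ {t | (s / 2) ^ 2 ≤ ‖g₂ t‖ ^ 2} := by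
    intro t ht
    have ht' : s < ‖g t‖ := ht
    have htri : ‖g t‖ ≤ ‖g₂ t‖ + ‖Torus.trigPoly S (mFourierCoeff g) t‖ := by
      have : g t = g₂ t + Torus.trigPoly S (mFourierCoeff g) t := by simp [hg₂]
      rw [this] at ht' ⊢
      simpa using norm_add_le (g₂ t) (Torus.trigPoly S (mFourierCoeff g) t)
    have hge : s / 2 ≤ ‖g₂ t‖ := by linarith [h1 t]
    show (s / 2) ^ 2 ≤ ‖g₂ t‖ ^ 2
    exact pow_le_pow_left₀ (by linarith) hge 2
  -- Chebyshev
  have hint2 : Integrable (fun t => ‖g₂ t‖ ^ 2) (volume : Measure (UnitAddTorus (Fin d))) :=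
    hsub.integrable_norm_pow two_ne_zero
  have hmarkov := mul_meas_ge_le_integral_of_nonneg (ae_of_all _ fun t => sq_nonneg ‖g₂ t‖) hint2 ((s / 2) ^ 2)
  have hs2 : 0 < (s / 2) ^ 2 := by positivity
  calc volume.real {t : UnitAddTorus (Fin d) | s < ‖g t‖}
      ≤ volume.real {t : UnitAddTorus (Fin d) | (s / 2) ^ 2 ≤ ‖g₂ t‖ ^ 2} := measureReal_mono hincl
    _ ≤ (∫ t, ‖g₂ t‖ ^ 2) / (s / 2) ^ 2 := by
        rw [le_div_iff₀ hs2, mul_comm]; exact hmarkov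
    _ ≤ (K ^ 2 * ∑' y, {y : Site d | euclidNorm y ≤ R}ᶜ.indicator (fun y => jnorm y ^ (-(2 * b))) y) /
          (s / 2) ^ 2 := by gcongr
    _ = 4 * (K ^ 2 * ∑' y, {y : Site d | euclidNorm y ≤ R}ᶜ.indicator (fun y => jnorm y ^ (-(2 * b))) y) /
          s ^ 2 := by
        field_simp
        ring

/-! ## Part 3. Layer-cake integration of a weak-type bound -/

/-- **From weak type to strong type below the critical exponent** (the real-interpolation step,
on a probability space): if `μ{f > s} ≤ A s^{-q₀}` for `s ≥ s⋆ > 0`, then for `0 < q < q₀`,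
`∫ f^q ≤ s⋆^q + q A s⋆^{q-q₀}/(q₀ - q)` (layer-cake formula, `μ ≤ 1` below `s⋆`). [folklore] -/
theorem lintegral_rpow_le_of_meas_gt_le {α : Type*} [MeasurableSpace α] (μ : Measure α)
    [IsProbabilityMeasure μ] {f : α → ℝ} (hf : AEMeasurable f μ) (hf0 : 0 ≤ᵐ[μ] f)
    {q q₀ A sstar : ℝ} (hq : 0 < q) (hqq₀ : q < q₀) (hA : 0 ≤ A) (hs : 0 < sstar)
    (hbound : ∀ s : ℝ, sstar ≤ s → μ {a | s < f a} ≤ ENNReal.ofReal (A * s ^ (-q₀))) :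
    ∫⁻ a, ENNReal.ofReal (f a ^ q) ∂μ ≤
      ENNReal.ofReal (sstar ^ q + q * A * sstar ^ (q - q₀) / (q₀ - q)) := by
  rw [lintegral_rpow_eq_lintegral_meas_lt_mul μ hf0 hf hq]
  set F : ℝ → ℝ≥0∞ := fun t => μ {a | t < f a} * ENNReal.ofReal (t ^ (q - 1)) with hF
  -- split `(0, ∞) = (0, s⋆] ∪ (s⋆, ∞)`
  have hsplit : ∫⁻ t in Set.Ioi 0, F t ≤ (∫⁻ t in Set.Ioc 0 sstar, F t) + ∫⁻ t in Set.Ioi sstar, F t := by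
    rw [← Set.Ioc_union_Ioi_eq_Ioi hs.le]
    exact lintegral_union_le F _ _
  -- the low piece: `μ ≤ 1`
  have hlow : ∫⁻ t in Set.Ioc 0 sstar, F t ≤ ENNReal.ofReal (sstar ^ q / q) := by
    have hle : ∫⁻ t in Set.Ioc 0 sstar, F t ≤ ∫⁻ t in Set.Ioc 0 sstar, ENNReal.ofReal (t ^ (q - 1)) := by
      refine lintegral_mono fun t => ?_
      simp only [hF]
      calc μ {a | t < f a} * ENNReal.ofReal (t ^ (q - 1))
          ≤ 1 * ENNReal.ofReal (t ^ (q - 1)) := by gcongr; exact prob_le_one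
        _ = ENNReal.ofReal (t ^ (q - 1)) := one_mul _
    refine hle.trans (le_of_eq ?_)
    have hint : IntegrableOn (fun t : ℝ => t ^ (q - 1)) (Set.Ioc 0 sstar) := by
      have h := intervalIntegral.intervalIntegrable_rpow' (a := 0) (b := sstar) (r := q - 1) (by linarith)
      rw [intervalIntegrable_iff_integrableOn_Ioc_of_le hs.le] at h
      exact h
    rw [← ofReal_integral_eq_lintegral_ofReal hint
      ((ae_restrict_mem measurableSet_Ioc).mono fun t ht => Real.rpow_nonneg ht.1.le _)]
    congr 1
    rw [← intervalIntegral.integral_of_le hs.le, integral_rpow (Or.inl (by linarith))]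
    rw [Real.zero_rpow (by linarith), sub_zero, sub_add_cancel]
  -- the high piece: the weak-type bound
  have hhigh : ∫⁻ t in Set.Ioi sstar, F t ≤ ENNReal.ofReal (A * sstar ^ (q - q₀) / (q₀ - q)) := by
    have hle : ∫⁻ t in Set.Ioi sstar, F t ≤
        ∫⁻ t in Set.Ioi sstar, ENNReal.ofReal (A * t ^ (q - 1 - q₀)) := by
      refine setLIntegral_mono' measurableSet_Ioi fun t ht => ?_
      have ht0 : 0 < t := hs.trans ht
      simp only [hF]
      calc μ {a | t < f a} * ENNReal.ofReal (t ^ (q - 1))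
          ≤ ENNReal.ofReal (A * t ^ (-q₀)) * ENNReal.ofReal (t ^ (q - 1)) := by
            gcongr; exact hbound t ht.le
        _ = ENNReal.ofReal (A * t ^ (q - 1 - q₀)) := by
            rw [← ENNReal.ofReal_mul (by positivity)]
            congr 1
            rw [mul_assoc, ← Real.rpow_add ht0]
            ring_nf
    refine hle.trans (le_of_eq ?_)
    have hexp : q - 1 - q₀ < -1 := by linarith
    have hint : IntegrableOn (fun t : ℝ => A * t ^ (q - 1 - q₀)) (Set.Ioi sstar) :=
      (integrableOn_Ioi_rpow_of_lt hexp hs).const_mul A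
    rw [← ofReal_integral_eq_lintegral_ofReal hint
      ((ae_restrict_mem measurableSet_Ioi).mono fun t ht =>
        mul_nonneg hA (Real.rpow_nonneg (hs.trans ht).le _))]
    congr 1
    rw [integral_const_mul, integral_Ioi_rpow_of_lt hexp hs]
    have hq0q : q₀ - q ≠ 0 := by linarith
    rw [show q - 1 - q₀ + 1 = q - q₀ by ring,
      show (q - q₀ : ℝ) = -(q₀ - q) by ring, div_neg, neg_div, neg_neg, mul_div_assoc]
  -- assemble
  have hq' : ENNReal.ofReal q ≠ ⊤ := ENNReal.ofReal_ne_top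
  calc ENNReal.ofReal q * ∫⁻ t in Set.Ioi 0, F t
      ≤ ENNReal.ofReal q * (ENNReal.ofReal (sstar ^ q / q) + ENNReal.ofReal (A * sstar ^ (q - q₀) / (q₀ - q))) := by
        gcongr
        exact hsplit.trans (add_le_add hlow hhigh)
    _ = ENNReal.ofReal (sstar ^ q + q * A * sstar ^ (q - q₀) / (q₀ - q)) := by
        have h1 : 0 ≤ sstar ^ q / q := by positivity
        have h2 : 0 ≤ A * sstar ^ (q - q₀) / (q₀ - q) :=
          div_nonneg (mul_nonneg hA (Real.rpow_nonneg hs.le _)) (by linarith)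
        rw [← ENNReal.ofReal_add h1 h2, ← ENNReal.ofReal_mul hq.le]
        congr 1
        rw [mul_add, show q * (sstar ^ q / q) = sstar ^ q by field_simp]
        ring


/-! ## Part 4. Liu–Slade 2024, Lemma 2.6 -/

/-- Exponent bookkeeping: `2 + (2b-d)/(d-b) = d/(d-b)`. [folklore] -/
theorem two_add_div_eq_div {dd b : ℝ} (h : b < dd) :
    2 + (2 * b - dd) / (dd - b) = dd / (dd - b) := by
  have : dd - b ≠ 0 := by linarith
  field_simp
  ring

/-- Constant bookkeeping for the weak-type bound:
`4K²C₂(s/(MK))^{-θ}/s² = 4C₂M^θ K^{2+θ} s^{-(2+θ)}`. [folklore] -/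
theorem weak_const_identity {K s M C₂ θ : ℝ} (hK : 0 < K) (hs : 0 < s) (hM : 0 < M) :
    4 * (K ^ 2 * (C₂ * (s / (M * K)) ^ (-θ))) / s ^ 2 =
      4 * C₂ * M ^ θ * K ^ (2 + θ) * s ^ (-(2 + θ)) := by
  rw [Real.rpow_neg (by positivity), Real.div_rpow hs.le (by positivity), Real.mul_rpow hM.le hK.le,
    Real.rpow_neg hs.le, Real.rpow_add hs, Real.rpow_add hK, Real.rpow_two, Real.rpow_two]
  have h1 : s ^ θ ≠ 0 := (Real.rpow_pos_of_pos hs θ).ne'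
  have h2 : K ^ θ ≠ 0 := (Real.rpow_pos_of_pos hK θ).ne'
  have h3 : M ^ θ ≠ 0 := (Real.rpow_pos_of_pos hM θ).ne'
  field_simp

/-- **Liu–Slade 2024, Lemma 2.6 (ii) (the Hausdorff–Young-type bound), for `2 ≤ q < d/(d-b)`.**
"Let `h : ℤ^d → ℝ` obey `|h(x)| ≤ K⟦x⟧^{-b}` for some `K, b > 0`. … If `d/2 < b ≤ d` then
`ĥ ∈ L^q(𝕋^d)` and `‖ĥ‖_q ≤ c_{d,b,q} K` for all `1 ≤ q < d/(d-b)`." Here `b < d` (the case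
`b ≥ d` is `LiuSlade2024_lem26_ii_of_le` below), `2 ≤ q` (the extension to `1 ≤ q < 2` is the
monotonicity of `L^q(𝕋^d)` norms on the probability space `𝕋^d`, as in the source), `ĥ` is any
`g ∈ L²(𝕋^d)` whose Fourier coefficients `ĝ(x) = ∫ e_{-x} g` obey `|ĝ(x)| ≤ K⟦x⟧^{-b}` (complex
coefficients allowed; for `h ∈ ℓ²` this is the `L²` Fourier transform of `h`, for finitely
supported `h` the trigonometric polynomial `Σ_x h(x)e_x`), norms are for the Haar probability
measure `dk/(2π)^d` (H21's `volume` on `UnitAddTorus (Fin d)`), and `c` depends on `d, b, q` only.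
PROOF (replacing the source's appeal to the Hausdorff–Young inequality, which is not in Mathlib,
by real interpolation by hand): split `g = g₁ + g₂` at frequency radius `R`, `‖g₁‖_∞ ≤ K C₁ R^{d-b}`
(`ℓ¹` part), `‖g₂‖₂² ≤ K² C₂ R^{d-2b}` (Parseval); with `R^{d-b} = s/(2K(C₁+1))` Chebyshev gives the
weak-type bound `vol{|g| > s} ≤ A K^{q₀} s^{-q₀}`, `q₀ = d/(d-b)`, for `s ≥ 2(C₁+1)K`, and the
layer-cake formula integrates it to `‖g‖_q ≤ c K` for `q < q₀`.
[cite: LiuSlade2024, Lemma 2.6 (ii)] -/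
theorem LiuSlade2024_lem26_ii (hd : 1 ≤ d) {b q : ℝ} (hdb : (d : ℝ) / 2 < b) (hbd : b < d)
    (hq2 : 2 ≤ q) (hq : q < d / (d - b)) :
    ∃ c : ℝ, 0 ≤ c ∧ ∀ (K : ℝ) (g : UnitAddTorus (Fin d) → ℂ), 0 ≤ K →
      MemLp g 2 (volume : Measure (UnitAddTorus (Fin d))) →
      (∀ x : Site d, ‖mFourierCoeff g x‖ ≤ K / jnorm x ^ b) →
      MemLp g (ENNReal.ofReal q) (volume : Measure (UnitAddTorus (Fin d))) ∧
        eLpNorm g (ENNReal.ofReal q) volume ≤ ENNReal.ofReal (c * K) := by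
  obtain ⟨C₁, hC₁, hball⟩ := exists_tsum_ball_jnorm_rpow_neg_le hd (a := b) (by linarith) hbd
  obtain ⟨C₂, hC₂, htail⟩ := exists_tsum_tail_jnorm_rpow_neg_le hd (s := 2 * b) (by linarith)
  have hdb' : 0 < (d : ℝ) - b := by linarith
  set θ : ℝ := (2 * b - d) / (d - b) with hθ
  have hθ0 : 0 < θ := div_pos (by linarith) hdb'
  set q₀ : ℝ := 2 + θ with hq₀
  have hq₀eq : q₀ = d / (d - b) := two_add_div_eq_div hbd
  have hqq₀ : q < q₀ := by rw [hq₀eq]; exact hq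
  have hq0 : 0 < q := by linarith
  set M : ℝ := 2 * (C₁ + 1) with hM
  have hM0 : 0 < M := by positivity
  set A₀ : ℝ := 4 * C₂ * M ^ θ with hA₀
  have hA₀0 : 0 ≤ A₀ := by positivity
  set B : ℝ := M ^ q + q * A₀ * M ^ (q - q₀) / (q₀ - q) with hB
  have hB0 : 0 ≤ B := by
    have : 0 ≤ q * A₀ * M ^ (q - q₀) / (q₀ - q) := div_nonneg (by positivity) (by linarith)
    positivity
  refine ⟨B ^ q⁻¹, Real.rpow_nonneg hB0 _, fun K g hK hg2 hg => ?_⟩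
  have hp0 : ENNReal.ofReal q ≠ 0 := (ENNReal.ofReal_pos.2 hq0).ne'
  have hptop : ENNReal.ofReal q ≠ ⊤ := ENNReal.ofReal_ne_top
  rcases hK.eq_or_lt with hK0 | hKpos
  · -- `K = 0`: all coefficients vanish, so `g = 0` a.e.
    subst hK0
    have hcoeff : ∀ x : Site d, mFourierCoeff g x = 0 := fun x =>
      norm_le_zero_iff.1 (by simpa using hg x)
    have hae := ae_eq_zero_of_forall_mFourierCoeff_eq_zero hg2 hcoeff
    refine ⟨(memLp_const 0).ae_eq hae.symm, ?_⟩
    rw [eLpNorm_congr_ae hae, eLpNorm_zero]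
    exact bot_le
  · set sstar : ℝ := M * K with hsstar
    have hs0 : 0 < sstar := by positivity
    -- the weak-type bound above `s⋆`
    have hdist : ∀ s : ℝ, sstar ≤ s →
        volume {t : UnitAddTorus (Fin d) | s < ‖g t‖} ≤ ENNReal.ofReal (A₀ * K ^ q₀ * s ^ (-q₀)) := by
      intro s hs
      have hspos : 0 < s := hs0.trans_le hs
      set u : ℝ := s / (M * K) with hu
      have hu1 : 1 ≤ u := by rwa [hu, le_div_iff₀ (by positivity), one_mul]
      have hu0 : 0 < u := by linarith
      set R : ℝ := u ^ (1 / ((d : ℝ) - b)) with hR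
      have hR1 : 1 ≤ R := Real.one_le_rpow hu1 (by positivity)
      have hmax : max R 1 = R := max_eq_left hR1
      have hRpow : R ^ ((d : ℝ) - b) = u := by
        rw [hR, one_div, Real.rpow_inv_rpow hu0.le hdb'.ne']
      have hRpow2 : R ^ ((d : ℝ) - 2 * b) = u ^ (-θ) := by
        rw [hR, one_div, ← Real.rpow_mul hu0.le]
        congr 1
        rw [hθ]
        field_simp
        ring
      have hsmall : K * ∑' y, {y : Site d | euclidNorm y ≤ R}.indicator (fun y => jnorm y ^ (-b)) y ≤ s / 2 := by
        calc K * ∑' y, {y : Site d | euclidNorm y ≤ R}.indicator (fun y => jnorm y ^ (-b)) y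
            ≤ K * (C₁ * (max R 1) ^ ((d : ℝ) - b)) := by gcongr; exact hball R
          _ = K * C₁ * u := by rw [hmax, hRpow]; ring
          _ ≤ K * (C₁ + 1) * u := by gcongr; linarith
          _ = s / 2 := by rw [hu, hM]; field_simp
      have hmeas := measureReal_norm_gt_le hg2 (by linarith) hg hspos hsmall
      have htailR : ∑' y, {y : Site d | euclidNorm y ≤ R}ᶜ.indicator (fun y => jnorm y ^ (-(2 * b))) y ≤
          C₂ * u ^ (-θ) := by
        have h := htail R
        rwa [hmax, hRpow2] at h
      have hreal : volume.real {t : UnitAddTorus (Fin d) | s < ‖g t‖} ≤ A₀ * K ^ q₀ * s ^ (-q₀) := by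
        calc volume.real {t : UnitAddTorus (Fin d) | s < ‖g t‖}
            ≤ 4 * (K ^ 2 * ∑' y, {y : Site d | euclidNorm y ≤ R}ᶜ.indicator
                (fun y => jnorm y ^ (-(2 * b))) y) / s ^ 2 := hmeas
          _ ≤ 4 * (K ^ 2 * (C₂ * u ^ (-θ))) / s ^ 2 := by gcongr
          _ = A₀ * K ^ q₀ * s ^ (-q₀) := by
              rw [hu, weak_const_identity hKpos hspos hM0, hA₀, hq₀]
      rw [← ENNReal.ofReal_toReal (measure_ne_top volume _)]
      exact ENNReal.ofReal_le_ofReal hreal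
    -- layer cake
    have hf : AEMeasurable (fun t => ‖g t‖) (volume : Measure (UnitAddTorus (Fin d))) :=
      hg2.1.norm.aemeasurable
    have hlc := lintegral_rpow_le_of_meas_gt_le volume hf (ae_of_all _ fun t => norm_nonneg (g t))
      hq0 hqq₀ (by positivity : 0 ≤ A₀ * K ^ q₀) hs0 hdist
    -- the value of the bound is `(cK)^q`
    have hKq : K ^ q₀ * K ^ (q - q₀) = K ^ q := by
      rw [← Real.rpow_add hKpos]; ring_nf
    have hval : sstar ^ q + q * (A₀ * K ^ q₀) * sstar ^ (q - q₀) / (q₀ - q) = (B ^ q⁻¹ * K) ^ q := by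
      calc sstar ^ q + q * (A₀ * K ^ q₀) * sstar ^ (q - q₀) / (q₀ - q)
          = M ^ q * K ^ q + q * A₀ * M ^ (q - q₀) * (K ^ q₀ * K ^ (q - q₀)) / (q₀ - q) := by
            rw [hsstar, Real.mul_rpow hM0.le hK, Real.mul_rpow hM0.le hK]; ring
        _ = B * K ^ q := by rw [hKq, hB]; ring
        _ = (B ^ q⁻¹ * K) ^ q := by
            rw [Real.mul_rpow (Real.rpow_nonneg hB0 _) hK, Real.rpow_inv_rpow hB0 hq0.ne']
    have hlint : ∫⁻ t, ‖g t‖ₑ ^ q ∂(volume : Measure (UnitAddTorus (Fin d))) ≤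
        ENNReal.ofReal ((B ^ q⁻¹ * K) ^ q) := by
      have heq : ∀ t, ‖g t‖ₑ ^ q = ENNReal.ofReal (‖g t‖ ^ q) := fun t => by
        rw [← ofReal_norm, ENNReal.ofReal_rpow_of_nonneg (norm_nonneg _) hq0.le]
      simp_rw [heq]
      rw [← hval]
      exact hlc
    have heLp : eLpNorm g (ENNReal.ofReal q) volume ≤ ENNReal.ofReal (B ^ q⁻¹ * K) := by
      rw [eLpNorm_eq_lintegral_rpow_enorm_toReal hp0 hptop, ENNReal.toReal_ofReal hq0.le]
      calc (∫⁻ t, ‖g t‖ₑ ^ q ∂(volume : Measure (UnitAddTorus (Fin d)))) ^ (1 / q)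
          ≤ (ENNReal.ofReal ((B ^ q⁻¹ * K) ^ q)) ^ (1 / q) := by gcongr
        _ = ENNReal.ofReal (B ^ q⁻¹ * K) := by
            rw [ENNReal.ofReal_rpow_of_nonneg (by positivity) (by positivity), one_div,
              Real.rpow_rpow_inv (by positivity) hq0.ne']
    exact ⟨⟨hg2.1, lt_of_le_of_lt heLp ENNReal.ofReal_lt_top⟩, heLp⟩

/-- **Lemma 2.6 (ii) at and beyond the endpoint `b ≥ d`**: then `ĝ` obeys the hypothesis for every
`b' < d`, so `‖g‖_q ≤ c_{d,b,q} K` for EVERY `2 ≤ q < ∞` (the source's `q < d/(d-b) = ∞` for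
`b = d`; for `b > d` part (i) even gives `L^∞`). [cite: LiuSlade2024, Lemma 2.6 (ii) (case b = d)] -/
theorem LiuSlade2024_lem26_ii_of_le (hd : 1 ≤ d) {b q : ℝ} (hb : (d : ℝ) ≤ b) (hq2 : 2 ≤ q) :
    ∃ c : ℝ, 0 ≤ c ∧ ∀ (K : ℝ) (g : UnitAddTorus (Fin d) → ℂ), 0 ≤ K →
      MemLp g 2 (volume : Measure (UnitAddTorus (Fin d))) →
      (∀ x : Site d, ‖mFourierCoeff g x‖ ≤ K / jnorm x ^ b) →
      MemLp g (ENNReal.ofReal q) (volume : Measure (UnitAddTorus (Fin d))) ∧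
        eLpNorm g (ENNReal.ofReal q) volume ≤ ENNReal.ofReal (c * K) := by
  have hd0 : (0 : ℝ) < d := by exact_mod_cast hd
  have hq0 : 0 < q := by linarith
  -- `b' = d - d/(2q) ∈ (d/2, d)` with `q < d/(d - b') = 2q`
  set b' : ℝ := d - d / (2 * q) with hb'
  have h1 : (d : ℝ) / 2 < b' := by
    rw [hb']
    have : (d : ℝ) / (2 * q) < d / 2 := by
      rw [div_lt_div_iff_of_pos_left hd0 (by positivity) (by positivity)]; linarith
    linarith
  have h2 : b' < d := by
    rw [hb']
    have : 0 < (d : ℝ) / (2 * q) := by positivity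
    linarith
  have h3 : q < d / (d - b') := by
    have hden : (d : ℝ) - b' = d / (2 * q) := by rw [hb']; ring
    rw [hden, div_div_eq_mul_div]
    have h' : (d : ℝ) * (2 * q) / d = 2 * q := by field_simp
    rw [h']
    linarith
  obtain ⟨c, hc, h⟩ := LiuSlade2024_lem26_ii hd h1 h2 hq2 h3
  refine ⟨c, hc, fun K g hK hg2 hg => h K g hK hg2 fun x => (hg x).trans ?_⟩
  exact div_jnorm_rpow_mono hK (by linarith)

/-- **Liu–Slade 2024, Lemma 2.6 (i):** "If `b > d` then `h ∈ ℓ¹(ℤ^d)`, `ĥ ∈ L^∞(𝕋^d)`, and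
`‖ĥ‖_∞ ≤ c_{d,b} K`" — for (complex) coefficients `|c_x| ≤ K⟦x⟧^{-b}`: `Σ_x |c_x| < ∞` and
`|Σ_x c_x e_x(t)| ≤ (Σ_x ⟦x⟧^{-b}) K` for every `t`. [cite: LiuSlade2024, Lemma 2.6 (i)] -/
theorem LiuSlade2024_lem26_i {b : ℝ} (hb : (d : ℝ) < b) :
    ∃ C : ℝ, 0 ≤ C ∧ ∀ (K : ℝ) (c : Site d → ℂ), (∀ x : Site d, ‖c x‖ ≤ K / jnorm x ^ b) →
      (Summable fun x => ‖c x‖) ∧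
        ∀ t : UnitAddTorus (Fin d), ‖∑' x, c x * mFourier x t‖ ≤ C * K := by
  have hsum : Summable fun x : Site d => jnorm x ^ (-b) := summable_jnorm_rpow_neg hb
  refine ⟨∑' x : Site d, jnorm x ^ (-b), tsum_nonneg fun x => Real.rpow_nonneg (jnorm_pos x).le _,
    fun K c hc => ?_⟩
  have hK : 0 ≤ K := by
    have h := (norm_nonneg _).trans (hc 0)
    rwa [jnorm_zero, Real.one_rpow, div_one] at h
  have hle : ∀ x : Site d, ‖c x‖ ≤ K * jnorm x ^ (-b) := fun x => by
    rw [Real.rpow_neg (jnorm_pos x).le, ← div_eq_mul_inv]; exact hc x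
  have hcs : Summable fun x => ‖c x‖ :=
    Summable.of_nonneg_of_le (fun x => norm_nonneg _) hle (hsum.mul_left K)
  refine ⟨hcs, fun t => ?_⟩
  have hterm : Summable fun x : Site d => ‖c x * mFourier x t‖ := by
    refine hcs.congr fun x => ?_
    rw [norm_mul, Torus.norm_mFourier_apply, mul_one]
  calc ‖∑' x, c x * mFourier x t‖ ≤ ∑' x, ‖c x * mFourier x t‖ := norm_tsum_le_tsum_norm hterm
    _ = ∑' x, ‖c x‖ := tsum_congr fun x => by rw [norm_mul, Torus.norm_mFourier_apply, mul_one]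
    _ ≤ ∑' x, K * jnorm x ^ (-b) := Summable.tsum_le_tsum hle hcs (hsum.mul_left K)
    _ = (∑' x : Site d, jnorm x ^ (-b)) * K := by rw [tsum_mul_left, mul_comm]

/-- The first clause of Lemma 2.6 (ii): "If `b ≤ d` then `h ∈ ℓ^p(ℤ^d)` for `p > d/b`" — for
coefficients `|c_x| ≤ K⟦x⟧^{-b}` (`b > 0`), `Σ_x |c_x|^p < ∞` whenever `pb > d` (summability of
`⟦x⟧^{-pb}`). [cite: LiuSlade2024, Lemma 2.6 (ii) (first clause)] -/
theorem summable_norm_rpow_of_decay {b p K : ℝ} {c : Site d → ℂ} (hp : 0 ≤ p) (hpb : (d : ℝ) < p * b)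
    (hc : ∀ x : Site d, ‖c x‖ ≤ K / jnorm x ^ b) :
    Summable fun x : Site d => ‖c x‖ ^ p := by
  have hK : 0 ≤ K := by
    have h := (norm_nonneg _).trans (hc 0)
    rwa [jnorm_zero, Real.one_rpow, div_one] at h
  refine Summable.of_nonneg_of_le (fun x => Real.rpow_nonneg (norm_nonneg _) _) (fun x => ?_)
    ((summable_jnorm_rpow_neg hpb).mul_left (K ^ p))
  have hj := jnorm_pos x
  calc ‖c x‖ ^ p ≤ (K / jnorm x ^ b) ^ p := Real.rpow_le_rpow (norm_nonneg _) (hc x) hp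
    _ = K ^ p * jnorm x ^ (-(p * b)) := by
        rw [Real.div_rpow hK (Real.rpow_nonneg hj.le _), ← Real.rpow_mul hj.le, Real.rpow_neg hj.le,
          div_eq_mul_inv, mul_comm b p]


/-- **Riesz–Fischer for power-decaying complex coefficients**: if `|c_x| ≤ K⟦x⟧^{-b}` with
`b > d/2` then `c ∈ ℓ²(ℤ^d)` and `c` is the sequence of Fourier coefficients of an `L²(𝕋^d)`
function `g` ("the condition `b > d/2` ensures that `h ∈ ℓ²(ℤ^d)`, so that we can use the `L²`
Fourier transform"); `LiuSlade2024_lem26_ii` then applies to this `g`. [cite: LiuSlade2024, Lemma 2.6 (ii) (proof, first sentence of the second claim)] -/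
theorem exists_memLp_two_of_decay {c : Site d → ℂ} {K b : ℝ} (hb : (d : ℝ) < 2 * b)
    (hc : ∀ x : Site d, ‖c x‖ ≤ K / jnorm x ^ b) :
    ∃ g : UnitAddTorus (Fin d) → ℂ, MemLp g 2 (volume : Measure (UnitAddTorus (Fin d))) ∧
      ∀ x : Site d, mFourierCoeff g x = c x := by
  have h2 : Summable fun x : Site d => ‖c x‖ ^ (2 : ℝ) :=
    summable_norm_rpow_of_decay zero_le_two (by linarith) hc
  have hmem : Memℓp c 2 := by
    rw [memℓp_gen_iff (by norm_num)]
    simpa using h2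
  set cl : lp (fun _ : Site d => ℂ) 2 := ⟨c, hmem⟩ with hcl
  set G : Lp ℂ 2 (Measure.pi fun _ : Fin d => AddCircle.haarAddCircle) :=
    (mFourierBasis (d := Fin d)).repr.symm cl with hG
  have hGmem : MemLp (G : UnitAddTorus (Fin d) → ℂ) 2 (volume : Measure (UnitAddTorus (Fin d))) := by
    rw [Torus.volume_eq_pi_haarAddCircle]; exact Lp.memLp G
  refine ⟨G, hGmem, fun x => ?_⟩
  have h1 : mFourierCoeff (G : UnitAddTorus (Fin d) → ℂ) x = (mFourierBasis (d := Fin d)).repr G x :=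
    (mFourierBasis_repr G x).symm
  rw [h1, hG, LinearIsometryEquiv.apply_symm_apply]

/-! ## Part 5. The weak-Lebesgue-class form -/

/-- `(d-b)/d < 1/q` with `b < d`, `q > 0` is `q < d/(d-b)`. [folklore] -/
theorem lt_div_of_div_lt_one_div {dd b q : ℝ} (hbd : b < dd) (hq : 0 < q)
    (h : (dd - b) / dd < 1 / q) (hdd : 0 < dd) : q < dd / (dd - b) := by
  have hdb : 0 < dd - b := by linarith
  rw [div_lt_div_iff₀ hdd hq] at h
  rw [lt_div_iff₀ hdb]
  linarith

/-- **Lemma 2.6 (ii) as a weak Lebesgue class** (the input `hq` of `isWLT_of_bound_two_le`): a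
family `Φ_i ∈ L²(𝕋^d)` with UNIFORMLY power-decaying Fourier coefficients,
`|𝓕Φ_i(x)| ≤ K⟦x⟧^{-b}` with `b > d/2`, is of class `(d - b) ∨ 0` — i.e. `sup_i ‖Φ_i‖_p < ∞` for
every `p ≥ 1` with `((d-b) ∨ 0)/d < 1/p` (for `b < d`: all `p < d/(d-b)`; for `b ≥ d`: all `p`).
In the application `i` runs over the admissible data `F` of Assumption 1.1 together with the
truncation level of the approximants, for which `|x^γ F(x)| ≤ K₁⟦x⟧^{|γ|-d-2-ρ}` uniformly.
[cite: LiuSlade2024, Lemma 2.6 (ii) and proof of Lemma 2.5 ((2.19)–(2.20): F̂_γ ∈ L^r for r⁻¹ > (|γ|-2-ρ)/d)] -/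
theorem isWLT_of_mFourierCoeff_decay (hd : 1 ≤ d) {ι : Type*} {Φ : ι → UnitAddTorus (Fin d) → ℂ}
    {K b : ℝ} (hK : 0 ≤ K) (hdb : (d : ℝ) / 2 < b)
    (h2 : ∀ i, MemLp (Φ i) 2 (volume : Measure (UnitAddTorus (Fin d))))
    (hc : ∀ i (x : Site d), ‖mFourierCoeff (Φ i) x‖ ≤ K / jnorm x ^ b) :
    IsWLT d (max ((d : ℝ) - b) 0) Φ := by
  have hd0 : (0 : ℝ) < d := by exact_mod_cast hd
  -- uniform `L^q` bounds for all admissible `q ≥ 2`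
  have hq : ∀ q : ℝ, 2 ≤ q → max ((d : ℝ) - b) 0 / d < 1 / q →
      ∃ C : ℝ≥0, ∀ i, eLpNorm (Φ i) (ENNReal.ofReal q) volume ≤ C := by
    intro q hq2 hlt
    have hq0 : 0 < q := by linarith
    rcases lt_or_ge b d with hbd | hbd
    · rw [max_eq_left (by linarith)] at hlt
      obtain ⟨c, -, h⟩ := LiuSlade2024_lem26_ii hd hdb hbd hq2 (lt_div_of_div_lt_one_div hbd hq0 hlt hd0)
      exact ⟨(c * K).toNNReal, fun i => (h K (Φ i) hK (h2 i) (hc i)).2⟩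
    · obtain ⟨c, -, h⟩ := LiuSlade2024_lem26_ii_of_le hd hbd hq2
      exact ⟨(c * K).toNNReal, fun i => (h K (Φ i) hK (h2 i) (hc i)).2⟩
  refine isWLT_of_bound_two_le (fun i => (h2 i).1) ?_ hq
  -- the `L²` bound is the case `q = 2`
  have hlt2 : max ((d : ℝ) - b) 0 / d < 1 / 2 := by
    rw [div_lt_div_iff₀ hd0 two_pos, one_mul]
    rcases lt_or_ge b d with hbd | hbd
    · rw [max_eq_left (by linarith)]; linarith
    · rw [max_eq_right (by linarith)]; linarith
  obtain ⟨C, hC⟩ := hq 2 le_rfl hlt2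
  refine ⟨C, fun i => ?_⟩
  have h := hC i
  rwa [ENNReal.ofReal_ofNat] at h


/-- **The form used for the truncation approximants**: a family of trigonometric polynomials
`Σ_{x ∈ S_i} c_i(x) e_x` with `|c_i(x)| ≤ K⟦x⟧^{-b}` on `S_i` (`b > d/2`, one `K` for all `i`) is
of class `(d - b) ∨ 0`, with bounds independent of the (finite) frequency sets `S_i`.
[cite: LiuSlade2024, Lemma 2.6 (ii)] -/
theorem isWLT_trigPoly_of_decay (hd : 1 ≤ d) {ι : Type*} (S : ι → Finset (Site d))
    (c : ι → Site d → ℂ) {K b : ℝ} (hK : 0 ≤ K) (hdb : (d : ℝ) / 2 < b)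
    (hc : ∀ i, ∀ x ∈ S i, ‖c i x‖ ≤ K / jnorm x ^ b) :
    IsWLT d (max ((d : ℝ) - b) 0) (fun i => Torus.trigPoly (S i) (c i)) := by
  refine isWLT_of_mFourierCoeff_decay hd hK hdb (fun i => ?_) (fun i x => ?_)
  · exact (memLp_top_of_bound (Torus.continuous_trigPoly _ _).aestronglyMeasurable _
      (ae_of_all _ fun t => norm_trigPoly_le _ _ t)).mono_exponent le_top
  · rw [Torus.mFourierCoeff_trigPoly]
    split_ifs with hx
    · exact hc i x hx
    · rw [norm_zero]
      exact div_nonneg hK (Real.rpow_nonneg (jnorm_pos x).le _)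


/-! ## Part 6. Liu–Slade 2024, Lemma 2.14: the smeared version `‖U_u ĥ‖_q ≲ u^η K`

`U_u g(t) = g(t + u eⱼ) - g(t - u eⱼ)` is the tree's `torusDiff j u g` (Liu–Slade's `U_u` in the
coordinate `t = k/2π`, direction `j`); on the coefficients `𝓕(U_u g)(x) = (e^{2πixⱼu} - e^{-2πixⱼu})𝓕g(x)`
(`mFourierCoeff_torusDiff`), and `|e^{2πixⱼu} - e^{-2πixⱼu}| = 2|sin(2πxⱼu)| ≤ 2(2π)^η|u|^η⟦x⟧^η`,
so one power `η ∈ [0,1]` of decay is traded for the factor `|u|^η`, and Lemma 2.6 applies with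
`b - η` in place of `b`. -/

/-- `min(1, a) ≤ a^η` for `a ≥ 0`, `0 ≤ η ≤ 1`. [folklore] -/
theorem min_one_le_rpow_of_le_one {a η : ℝ} (ha : 0 ≤ a) (hη0 : 0 ≤ η) (hη1 : η ≤ 1) :
    min 1 a ≤ a ^ η := by
  rcases le_or_gt a 1 with h | h
  · rw [min_eq_right h]
    rcases ha.eq_or_lt with rfl | ha'
    · rcases hη0.eq_or_lt with rfl | hη
      · simp
      · rw [Real.zero_rpow hη.ne']
    · calc a = a ^ (1 : ℝ) := (Real.rpow_one a).symm
        _ ≤ a ^ η := Real.rpow_le_rpow_of_exponent_ge ha' h hη1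
  · rw [min_eq_left h.le]
    exact Real.one_le_rpow h.le hη0

/-- **`|e^{2πixⱼu} - e^{-2πixⱼu}| ≤ 2(2π)^η |u|^η ⟦x⟧^η`** for `0 ≤ η ≤ 1`
(`2|sin θ| ≤ 2 min(1,|θ|) ≤ 2|θ|^η`, `|xⱼ| ≤ ⟦x⟧`). [cite: LiuSlade2024, proof of Lemma 2.14 ("|sin(ux₁)| ≲ |ux₁|^η ≤ u^η|x|^η")] -/
theorem norm_fourier_sub_fourier_neg_le (x : Site d) (j : Fin d) (u : ℝ) {η : ℝ} (hη0 : 0 ≤ η)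
    (hη1 : η ≤ 1) :
    ‖(fourier (x j) ((u : ℝ) : UnitAddCircle) : ℂ) - fourier (x j) (((-u : ℝ)) : UnitAddCircle)‖ ≤
      2 * (2 * Real.pi) ^ η * |u| ^ η * jnorm x ^ η := by
  rw [norm_fourier_sub_fourier_neg]
  have hπ : 0 < Real.pi := Real.pi_pos
  set θ : ℝ := 2 * Real.pi * (x j) * u with hθ
  have h1 : |Real.sin θ| ≤ min 1 |θ| := le_min (Real.abs_sin_le_one θ) Real.abs_sin_le_abs
  have h2 : min 1 |θ| ≤ |θ| ^ η := min_one_le_rpow_of_le_one (abs_nonneg θ) hη0 hη1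
  have h3 : |θ| ≤ 2 * Real.pi * |u| * jnorm x := by
    rw [hθ, abs_mul, abs_mul, abs_of_pos (by positivity : (0 : ℝ) < 2 * Real.pi)]
    have hx : |((x j : ℤ) : ℝ)| ≤ jnorm x := (abs_apply_le_euclidNorm x j).trans (euclidNorm_le_jnorm x)
    calc 2 * Real.pi * |((x j : ℤ) : ℝ)| * |u| = 2 * Real.pi * |u| * |((x j : ℤ) : ℝ)| := by ring
      _ ≤ 2 * Real.pi * |u| * jnorm x := by gcongr
  have h4 : |θ| ^ η ≤ (2 * Real.pi * |u| * jnorm x) ^ η := Real.rpow_le_rpow (abs_nonneg θ) h3 hη0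
  calc 2 * |Real.sin θ| ≤ 2 * (2 * Real.pi * |u| * jnorm x) ^ η := by linarith [h1.trans (h2.trans h4)]
    _ = 2 * (2 * Real.pi) ^ η * |u| ^ η * jnorm x ^ η := by
        rw [Real.mul_rpow (by positivity) (jnorm_pos x).le, Real.mul_rpow (by positivity) (abs_nonneg u)]
        ring

/-- **The Fourier coefficients of `U_u g` decay like those of `g` with one power `η` traded for
`|u|^η`**: `|𝓕(U_u g)(x)| ≤ 2(2π)^η |u|^η K ⟦x⟧^{-(b-η)}` under `|𝓕g(x)| ≤ K⟦x⟧^{-b}`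
("`U_u ĥ` is the Fourier transform of `2i sin(ux₁)h(x)`", `|sin(ux₁)| ≲ u^η|x|^η`).
[cite: LiuSlade2024, proof of Lemma 2.14] -/
theorem norm_mFourierCoeff_torusDiff_le {g : UnitAddTorus (Fin d) → ℂ} (hg : Integrable g)
    {K b η : ℝ} (hη0 : 0 ≤ η) (hη1 : η ≤ 1)
    (hc : ∀ x : Site d, ‖mFourierCoeff g x‖ ≤ K / jnorm x ^ b) (j : Fin d) (u : ℝ) (x : Site d) :
    ‖mFourierCoeff (torusDiff j u g) x‖ ≤ (2 * (2 * Real.pi) ^ η * |u| ^ η * K) / jnorm x ^ (b - η) := by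
  have hK : 0 ≤ K := by
    have h := (norm_nonneg _).trans (hc 0)
    rwa [jnorm_zero, Real.one_rpow, div_one] at h
  have hj := jnorm_pos x
  rw [mFourierCoeff_torusDiff hg, norm_mul]
  calc ‖(fourier (x j) ((u : ℝ) : UnitAddCircle) : ℂ) - fourier (x j) (((-u : ℝ)) : UnitAddCircle)‖ *
        ‖mFourierCoeff g x‖
      ≤ (2 * (2 * Real.pi) ^ η * |u| ^ η * jnorm x ^ η) * (K / jnorm x ^ b) :=
        mul_le_mul (norm_fourier_sub_fourier_neg_le x j u hη0 hη1) (hc x) (norm_nonneg _) (by positivity)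
    _ = (2 * (2 * Real.pi) ^ η * |u| ^ η * K) / jnorm x ^ (b - η) := by
        rw [Real.rpow_sub hj, div_div_eq_mul_div]
        ring

/-- `U_u g ∈ L^p` whenever `g ∈ L^p` (translation invariance of Haar measure). [folklore] -/
theorem memLp_torusDiff {g : UnitAddTorus (Fin d) → ℂ} {p : ℝ≥0∞}
    (hg : MemLp g p (volume : Measure (UnitAddTorus (Fin d)))) (j : Fin d) (u : ℝ) :
    MemLp (torusDiff j u g) p (volume : Measure (UnitAddTorus (Fin d))) := by
  set e : UnitAddTorus (Fin d) := Pi.single j ((u : ℝ) : UnitAddCircle) with he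
  have h1 : MemLp (g ∘ fun t : UnitAddTorus (Fin d) => t + e) p volume :=
    hg.comp_measurePreserving (measurePreserving_add_right volume e)
  have h2 : MemLp (g ∘ fun t : UnitAddTorus (Fin d) => t + -e) p volume :=
    hg.comp_measurePreserving (measurePreserving_add_right volume (-e))
  have h3 : torusDiff j u g = fun t => (g ∘ fun t : UnitAddTorus (Fin d) => t + e) t -
      (g ∘ fun t : UnitAddTorus (Fin d) => t + -e) t := by
    funext t
    simp only [torusDiff, Function.comp_apply, he, sub_eq_add_neg]
  rw [h3]
  exact h1.sub h2

/-- **Liu–Slade 2024, Lemma 2.14 (ii)** (`2 ≤ q`; the smeared Hausdorff–Young-type bound used in the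
proof of Lemma 2.12 / Proposition 2.11): "Let `h : ℤ^d → ℝ` obey `|h(x)| ≤ K⟦x⟧^{-b}` for some
`K, b > 0`, and let `0 ≤ η ≤ 1`. … (ii) If `d/2 + η < b ≤ d + η` then `ĥ ∈ L^q(𝕋^d)` and
`‖U_u ĥ‖_q ≤ c_{d,b,q} u^η K` for all `1 ≤ q < d/(d - b + η)`." Here `b < d + η` (the endpoint is
`LiuSlade2024_lem214_ii_of_le`), `ĥ` is any `g ∈ L²(𝕋^d)` with `|𝓕g(x)| ≤ K⟦x⟧^{-b}`, `U_u` is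
`torusDiff j u` in ANY coordinate direction `j` and for EVERY real `u` (the bound is `c|u|^η K`;
the source takes `0 ≤ u ≤ 1` in the coordinate `k`, which changes the constant only), and
`1 ≤ q < 2` follows by monotonicity of norms as in the source. Proof: `norm_mFourierCoeff_torusDiff_le`
and Lemma 2.6 (ii) with `b - η`. [cite: LiuSlade2024, Lemma 2.14 (ii)] -/
theorem LiuSlade2024_lem214_ii (hd : 1 ≤ d) {b η q : ℝ} (hη0 : 0 ≤ η) (hη1 : η ≤ 1)
    (hdb : (d : ℝ) / 2 + η < b) (hbd : b < d + η) (hq2 : 2 ≤ q) (hq : q < d / (d - b + η)) :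
    ∃ c : ℝ, 0 ≤ c ∧ ∀ (K : ℝ) (g : UnitAddTorus (Fin d) → ℂ), 0 ≤ K →
      MemLp g 2 (volume : Measure (UnitAddTorus (Fin d))) →
      (∀ x : Site d, ‖mFourierCoeff g x‖ ≤ K / jnorm x ^ b) →
      ∀ (j : Fin d) (u : ℝ),
        MemLp (torusDiff j u g) (ENNReal.ofReal q) (volume : Measure (UnitAddTorus (Fin d))) ∧
          eLpNorm (torusDiff j u g) (ENNReal.ofReal q) volume ≤ ENNReal.ofReal (c * |u| ^ η * K) := by
  obtain ⟨c, hc, h⟩ := LiuSlade2024_lem26_ii hd (b := b - η) (q := q) (by linarith) (by linarith) hq2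
    (by rwa [show (d : ℝ) - (b - η) = d - b + η by ring])
  refine ⟨c * (2 * (2 * Real.pi) ^ η), by positivity, fun K g hK hg2 hg j u => ?_⟩
  have hdec := norm_mFourierCoeff_torusDiff_le (hg2.integrable one_le_two) hη0 hη1 hg j u
  have h' := h (2 * (2 * Real.pi) ^ η * |u| ^ η * K) (torusDiff j u g) (by positivity)
    (memLp_torusDiff hg2 j u) hdec
  refine ⟨h'.1, h'.2.trans (le_of_eq ?_)⟩
  congr 1
  ring

/-- **Lemma 2.14 (ii) at and beyond the endpoint `b ≥ d + η`**: every `2 ≤ q < ∞`.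
[cite: LiuSlade2024, Lemma 2.14 (ii) (case b = d + η)] -/
theorem LiuSlade2024_lem214_ii_of_le (hd : 1 ≤ d) {b η q : ℝ} (hη0 : 0 ≤ η) (hη1 : η ≤ 1)
    (hb : (d : ℝ) + η ≤ b) (hq2 : 2 ≤ q) :
    ∃ c : ℝ, 0 ≤ c ∧ ∀ (K : ℝ) (g : UnitAddTorus (Fin d) → ℂ), 0 ≤ K →
      MemLp g 2 (volume : Measure (UnitAddTorus (Fin d))) →
      (∀ x : Site d, ‖mFourierCoeff g x‖ ≤ K / jnorm x ^ b) →
      ∀ (j : Fin d) (u : ℝ),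
        MemLp (torusDiff j u g) (ENNReal.ofReal q) (volume : Measure (UnitAddTorus (Fin d))) ∧
          eLpNorm (torusDiff j u g) (ENNReal.ofReal q) volume ≤ ENNReal.ofReal (c * |u| ^ η * K) := by
  obtain ⟨c, hc, h⟩ := LiuSlade2024_lem26_ii_of_le hd (b := b - η) (q := q) (by linarith) hq2
  refine ⟨c * (2 * (2 * Real.pi) ^ η), by positivity, fun K g hK hg2 hg j u => ?_⟩
  have hdec := norm_mFourierCoeff_torusDiff_le (hg2.integrable one_le_two) hη0 hη1 hg j u
  have h' := h (2 * (2 * Real.pi) ^ η * |u| ^ η * K) (torusDiff j u g) (by positivity)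
    (memLp_torusDiff hg2 j u) hdec
  refine ⟨h'.1, h'.2.trans (le_of_eq ?_)⟩
  congr 1
  ring

/-- The characters at a point on a coordinate axis: `e_x(s eⱼ) = e^{2πi xⱼ s}`. [folklore] -/
theorem mFourier_apply_single (x : Site d) (j : Fin d) (a : UnitAddCircle) :
    mFourier x (Pi.single j a : UnitAddTorus (Fin d)) = fourier (x j) a := by
  simp only [mFourier, ContinuousMap.coe_mk]
  rw [Finset.prod_eq_single j]
  · rw [Pi.single_eq_same]
  · intro i _ hij
    rw [Pi.single_eq_of_ne hij, fourier_eval_zero]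
  · intro h
    exact absurd (Finset.mem_univ j) h

/-- `e_x(t ± u eⱼ) = e_x(t) e^{±2πi xⱼ u}`, so `|e_x(t + ueⱼ) - e_x(t - ueⱼ)| = |e^{2πixⱼu} - e^{-2πixⱼu}|`.
[folklore] -/
theorem norm_mFourier_add_sub_mFourier_sub (x : Site d) (j : Fin d) (u : ℝ) (t : UnitAddTorus (Fin d)) :
    ‖mFourier x (t + Pi.single j ((u : ℝ) : UnitAddCircle)) - mFourier x (t - Pi.single j ((u : ℝ) : UnitAddCircle))‖ =
      ‖(fourier (x j) ((u : ℝ) : UnitAddCircle) : ℂ) - fourier (x j) (((-u : ℝ)) : UnitAddCircle)‖ := by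
  have hplus : mFourier x (t + Pi.single j ((u : ℝ) : UnitAddCircle)) =
      mFourier x t * fourier (x j) ((u : ℝ) : UnitAddCircle) := by
    rw [Torus.mFourier_apply_add, mFourier_apply_single]
  have hminus : mFourier x (t - Pi.single j ((u : ℝ) : UnitAddCircle)) =
      mFourier x t * fourier (x j) (((-u : ℝ)) : UnitAddCircle) := by
    rw [sub_eq_add_neg, ← Pi.single_neg, ← AddCircle.coe_neg, Torus.mFourier_apply_add,
      mFourier_apply_single]
  rw [hplus, hminus, ← mul_sub, norm_mul, Torus.norm_mFourier_apply, one_mul]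

/-- **Liu–Slade 2024, Lemma 2.14 (i):** "If `b > d + η` then `ĥ ∈ L^∞(𝕋^d)` and
`‖U_u ĥ‖_∞ ≤ c_{b,η} u^η K`" — for coefficients `|c_x| ≤ K⟦x⟧^{-b}` and the absolutely convergent
series `ĥ = Σ_x c_x e_x`: `|U_u ĥ(t)| ≤ c |u|^η K` for every `t`, every direction and every real `u`.
[cite: LiuSlade2024, Lemma 2.14 (i)] -/
theorem LiuSlade2024_lem214_i {b η : ℝ} (hη0 : 0 ≤ η) (hη1 : η ≤ 1) (hb : (d : ℝ) + η < b) :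
    ∃ C : ℝ, 0 ≤ C ∧ ∀ (K : ℝ) (c : Site d → ℂ), (∀ x : Site d, ‖c x‖ ≤ K / jnorm x ^ b) →
      ∀ (j : Fin d) (u : ℝ) (t : UnitAddTorus (Fin d)),
        ‖torusDiff j u (fun s => ∑' x, c x * mFourier x s) t‖ ≤ C * |u| ^ η * K := by
  have hsum : Summable fun x : Site d => jnorm x ^ (-(b - η)) := summable_jnorm_rpow_neg (by linarith)
  refine ⟨2 * (2 * Real.pi) ^ η * ∑' x : Site d, jnorm x ^ (-(b - η)),
    mul_nonneg (by positivity) (tsum_nonneg fun x => Real.rpow_nonneg (jnorm_pos x).le _),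
    fun K c hc j u t => ?_⟩
  have hK : 0 ≤ K := by
    have h := (norm_nonneg _).trans (hc 0)
    rwa [jnorm_zero, Real.one_rpow, div_one] at h
  have hle0 : ∀ x : Site d, ‖c x‖ ≤ K * jnorm x ^ (-b) := fun x => by
    rw [Real.rpow_neg (jnorm_pos x).le, ← div_eq_mul_inv]; exact hc x
  have hcs : Summable fun x => ‖c x‖ :=
    Summable.of_nonneg_of_le (fun x => norm_nonneg _) hle0 ((summable_jnorm_rpow_neg (by linarith)).mul_left K)
  set e : UnitAddTorus (Fin d) := Pi.single j ((u : ℝ) : UnitAddCircle) with he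
  -- `U_u Σ c_x e_x = Σ c_x (e_x(t + ueⱼ) - e_x(t - ueⱼ))`, termwise bounded
  have hs1 : ∀ s : UnitAddTorus (Fin d), Summable fun x => c x * mFourier x s := fun s =>
    Summable.of_norm (hcs.congr fun x => by rw [norm_mul, Torus.norm_mFourier_apply, mul_one])
  have hdiff : torusDiff j u (fun s => ∑' x, c x * mFourier x s) t =
      ∑' x, c x * (mFourier x (t + e) - mFourier x (t - e)) := by
    rw [torusDiff, ← he, ← Summable.tsum_sub (hs1 _) (hs1 _)]
    exact tsum_congr fun x => by ring
  set A : ℝ := 2 * (2 * Real.pi) ^ η * |u| ^ η * K with hA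
  have hle : ∀ x : Site d, ‖c x * (mFourier x (t + e) - mFourier x (t - e))‖ ≤ A * jnorm x ^ (-(b - η)) := by
    intro x
    have hj := jnorm_pos x
    rw [norm_mul, he, norm_mFourier_add_sub_mFourier_sub]
    calc ‖c x‖ * ‖(fourier (x j) ((u : ℝ) : UnitAddCircle) : ℂ) - fourier (x j) (((-u : ℝ)) : UnitAddCircle)‖
        ≤ (K / jnorm x ^ b) * (2 * (2 * Real.pi) ^ η * |u| ^ η * jnorm x ^ η) :=
          mul_le_mul (hc x) (norm_fourier_sub_fourier_neg_le x j u hη0 hη1) (norm_nonneg _) (by positivity)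
      _ = A * jnorm x ^ (-(b - η)) := by
          rw [hA, Real.rpow_neg hj.le, Real.rpow_sub hj, inv_div, div_eq_mul_inv]
          ring
  have hsum' : Summable fun x : Site d => A * jnorm x ^ (-(b - η)) := hsum.mul_left _
  have hsn : Summable fun x : Site d => ‖c x * (mFourier x (t + e) - mFourier x (t - e))‖ :=
    Summable.of_nonneg_of_le (fun x => norm_nonneg _) hle hsum'
  rw [hdiff]
  calc ‖∑' x, c x * (mFourier x (t + e) - mFourier x (t - e))‖
      ≤ ∑' x, ‖c x * (mFourier x (t + e) - mFourier x (t - e))‖ := norm_tsum_le_tsum_norm hsn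
    _ ≤ ∑' x, A * jnorm x ^ (-(b - η)) := Summable.tsum_le_tsum hle hsn hsum'
    _ = 2 * (2 * Real.pi) ^ η * (∑' x : Site d, jnorm x ^ (-(b - η))) * |u| ^ η * K := by
        rw [tsum_mul_left, hA]; ring


/-- Fourier coefficients are homogeneous: `𝓕(a g)(x) = a 𝓕g(x)` (no integrability needed); a
private copy (under another name) of the tree's `mFourierCoeff_const_mul`
(`LaceExpansionIsingDeconvolutionThm22.lean`, not imported here). [folklore] -/
private theorem mFourierCoeff_scalar_mul (a : ℂ) (g : UnitAddTorus (Fin d) → ℂ) (x : Site d) :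
    mFourierCoeff (fun t => a * g t) x = a * mFourierCoeff g x := by
  unfold mFourierCoeff
  simp_rw [smul_eq_mul]
  rw [← integral_const_mul]
  exact integral_congr_ae (ae_of_all _ fun t => by ring)

/-- **Lemma 2.14 (ii) as a weak Lebesgue class**: for a family `Φ_i ∈ L²(𝕋^d)` with
`|𝓕Φ_i(x)| ≤ K⟦x⟧^{-b}`, `b > d/2 + η`, `0 ≤ η ≤ 1`, the rescaled differences
`|u|^{-η} U_u Φ_i` — indexed by `(i, j, u)`, every direction `j` and every real `u` (for `u = 0`
the member is `0`) — form a family of class `(d - b + η) ∨ 0`; i.e. `‖U_u Φ_i‖_p ≤ C_p |u|^η`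
uniformly in `i, j, u` for every admissible `p`. This is the shape in which Lemma 2.14 enters the
Hölder bookkeeping of Lemma 2.12 / Proposition 2.11. [cite: LiuSlade2024, Lemma 2.14 (ii) and proof of Lemma 2.12] -/
theorem isWLT_torusDiff_of_mFourierCoeff_decay (hd : 1 ≤ d) {ι : Type*}
    {Φ : ι → UnitAddTorus (Fin d) → ℂ} {K b η : ℝ} (hK : 0 ≤ K) (hη0 : 0 ≤ η) (hη1 : η ≤ 1)
    (hdb : (d : ℝ) / 2 + η < b)
    (h2 : ∀ i, MemLp (Φ i) 2 (volume : Measure (UnitAddTorus (Fin d))))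
    (hc : ∀ i (x : Site d), ‖mFourierCoeff (Φ i) x‖ ≤ K / jnorm x ^ b) :
    IsWLT d (max ((d : ℝ) - b + η) 0)
      (fun p : ι × Fin d × ℝ => fun t => (((|p.2.2| ^ η)⁻¹ : ℝ) : ℂ) * torusDiff p.2.1 p.2.2 (Φ p.1) t) := by
  rw [show (d : ℝ) - b + η = d - (b - η) by ring]
  refine isWLT_of_mFourierCoeff_decay hd (K := 2 * (2 * Real.pi) ^ η * K) (b := b - η) (by positivity)
    (by linarith) (fun p => ((memLp_torusDiff (h2 p.1) p.2.1 p.2.2).const_mul _)) (fun p x => ?_)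
  obtain ⟨i, j, u⟩ := p
  dsimp only
  rw [mFourierCoeff_scalar_mul, norm_mul, Complex.norm_real, Real.norm_eq_abs, abs_inv,
    abs_of_nonneg (Real.rpow_nonneg (abs_nonneg u) η)]
  have hdec := norm_mFourierCoeff_torusDiff_le ((h2 i).integrable one_le_two) hη0 hη1 (hc i) j u x
  have hj := jnorm_pos x
  rcases (Real.rpow_nonneg (abs_nonneg u) η).eq_or_lt with h0 | hpos
  · rw [← h0, inv_zero, zero_mul]
    positivity
  · calc (|u| ^ η)⁻¹ * ‖mFourierCoeff (torusDiff j u (Φ i)) x‖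
        ≤ (|u| ^ η)⁻¹ * ((2 * (2 * Real.pi) ^ η * |u| ^ η * K) / jnorm x ^ (b - η)) := by gcongr
      _ = 2 * (2 * Real.pi) ^ η * K / jnorm x ^ (b - η) := by
          field_simp

end Literature.Barriers.CriticalPhenomena.SpreadOutIsing

end
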